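import Summits.Ventures.HSemireg.WedgeHankelRecurrenceGaussChebyshevExample

/-!
# Venture HSemireg — **A RANK-ONE CHANGE OF THE LAST DIAGONAL COEFFICIENT: STRICT INTERLACING OF THE OLD AND NEW ZEROS**: the polynomial `q_{n+2} − c q_{n+1}` (the recurrence with `a_{n+1}`
# replaced by `a_{n+1} + c`, a quasi-orthogonal polynomial) has zeros `y_0 < ⋯ < y_{n+1}` with `x_k < y_k < x_{k+1}` for `c > 0` and `x_{k−1} < y_k < x_k` for `c < 0`, where `x` are the zeros of
# `q_{n+2}` — proved by the monotonicity of `q_{n+2}∕q_{n+1}` between the zeros of `q_{n+1}` (N331), on which the ratio takes the values `0` at `x_k` and `c` at `y_k`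

HONEST FRAMING. Part of the Lean index of the computation cell `pub-hsemireg` (seat p10 gen 44, Sunday typer «UNIFORM-IN-n»).  Real polynomials and the order structure of `ℝ` (convexity of
order-connected sets) only; no variety, no cohomology theory, no sheaf, no Ext group and no semiregularity map is constructed here; nothing here says that HC / HC_CM / HC_AV holds; no Literature
fact (unproved `Prop`) is declared or used.  Custodian versions as in `WedgeHankelSiegelIdeal` (1/3).
SOURCES (cited).  G. H. Golub, *Some modified matrix eigenvalue problems*, SIAM Review 15 (1973) 318–334 (§5: eigenvalues under a rank-one modification interlace the old ones and move in the
direction of the sign); J. H. Wilkinson, *The Algebraic Eigenvalue Problem* (1965) Ch. 2 §39–§40; J. A. Shohat, *On mechanical quadratures, in particular, with positive coefficients*, Trans. AMS 42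
(1937) 461–496 (zeros of the quasi-orthogonal polynomial `p_{n+1} − c p_n`); G. Szegő, *Orthogonal Polynomials*, Thm 3.3.4.
PROOF TYPED HERE.  Both `x` (N279) and `y` (N295) interlace the zeros `z` of `q_{n+1}`; on the order-connected (hence convex) set `S_k = {u : z_i < u (i < k), u < z_i (i ≥ k)}` the function
`q_{n+2}∕q_{n+1}` is strictly increasing (N331) and equals `0` at `x_k ∈ S_k`, `c` at `y_k ∈ S_k`.
DEDUP DISCLOSURE (`rg -n 'quasiOrthogonal_zeros|TopPerturbation|rank-one' Summits/Ventures/HSemireg`, 2026-09-03): N295 gives `y` interlacing `z`, N279 gives `x` interlacing `z`; the comparison of `x`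
with `y` is new.  The 4 names below: 0 hits tree-wide.

WHAT IS IN THE TREE.  N279 `recurrence_zeros_interlace`; N295 `quasiOrthogonal_zeros_interlace`; N294 `strictMono_eq_of_prod_X_sub_C_eq`; N331 `recurrence_ratio_strictMonoOn`; Mathlib
`Set.OrdConnected.convex`.
THIS FILE (namespace `Summit.Ventures.HSemireg.Wedge.HankelOuter` continued; CHAINED on N332 (import only), N331; 0 definitions):
* §1098 `gapSet_convex_and_ne` (the set `S_k` is convex and free of zeros of `q_{n+1}`), `mem_gapSet_of_interlace` (a vector interlacing `z` has its `k`-th entry in `S_k`),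
  **`top_perturbation_zeros_compare`** (`x_k < y_k` for `c > 0`, `y_k < x_k` for `c < 0`), **`top_perturbation_interlace`** (the zeros `x`, `y`, `z` with `x_k < y_k < z_k < x_{k+1}` for `c > 0`).
CAVEATS.  Positive recurrences; only the LAST diagonal coefficient is changed (general rank-one changes are not treated).  Nothing Ext-side.  New names only.
-/

open Module Polynomial
open scoped Matrix Polynomial

namespace Summit.Ventures.HSemireg.Wedge.HankelOuter

/-! ## §1098. Perturbing the last diagonal coefficient -/

/-- **The gap set `S_k = {u : z_i < u (i < k), u < z_i (k ≤ i)}` between consecutive zeros of `q_{n+1} = ∏ (X − z_i)` is convex and `q_{n+1}` does not vanish on it.** [this file, §1098] -/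
theorem gapSet_convex_and_ne {m : ℕ} (z : Fin m → ℝ) (P : ℝ[X]) (hP : P = ∏ i, (Polynomial.X - C (z i))) (k : ℕ) :
    Convex ℝ {u : ℝ | (∀ i : Fin m, (i : ℕ) < k → z i < u) ∧ ∀ i : Fin m, k ≤ (i : ℕ) → u < z i} ∧
      ∀ u ∈ {u : ℝ | (∀ i : Fin m, (i : ℕ) < k → z i < u) ∧ ∀ i : Fin m, k ≤ (i : ℕ) → u < z i}, P.eval u ≠ 0 := by
  refine ⟨Set.OrdConnected.convex ⟨fun u hu v hv w hw => ⟨fun i hi => (hu.1 i hi).trans_le hw.1, fun i hi => hw.2.trans_lt (hv.2 i hi)⟩⟩, fun u hu => ?_⟩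
  rw [hP, eval_prod]
  refine Finset.prod_ne_zero_iff.2 fun i _ => ?_
  rw [eval_sub, eval_X, eval_C, sub_ne_zero]
  rcases Nat.lt_or_ge (i : ℕ) k with h | h
  · exact (hu.1 i h).ne'
  · exact (hu.2 i h).ne

/-- **A vector `x` interlacing `z` (`x_i < z_i < x_{i+1}`) has `x_k ∈ S_k`.** [this file, §1098] -/
theorem mem_gapSet_of_interlace {n : ℕ} {z : Fin (n + 1) → ℝ} {x : Fin (n + 2) → ℝ} (hx : StrictMono x)
    (hint : ∀ i : Fin (n + 1), x i.castSucc < z i ∧ z i < x i.succ) (k : Fin (n + 2)) :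
    x k ∈ {u : ℝ | (∀ i : Fin (n + 1), (i : ℕ) < k → z i < u) ∧ ∀ i : Fin (n + 1), (k : ℕ) ≤ (i : ℕ) → u < z i} := by
  refine ⟨fun i hi => (hint i).2.trans_le (hx.monotone ?_), fun i hi => lt_of_le_of_lt (hx.monotone ?_) (hint i).1⟩
  · rw [Fin.le_def, Fin.val_succ]; omega
  · rw [Fin.le_def, Fin.val_castSucc]; exact hi

/-- **THE ZEROS MOVE IN THE DIRECTION OF `c`**: for the zeros `x` of `q_{n+2}` and `y` of `q_{n+2} − c·q_{n+1}`, both interlacing the zeros `z` of `q_{n+1}`, one has `x_k < y_k` if `c > 0` and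
`y_k < x_k` if `c < 0` (every `k`). [Golub 1973 §5; Shohat 1937; this file, §1098] -/
theorem top_perturbation_zeros_compare {q : ℕ → ℝ[X]} {a b : ℕ → ℝ} (hq0 : q 0 = 1) (hq1 : q 1 = Polynomial.X - C (a 0))
    (hrec : ∀ n, q (n + 2) = (Polynomial.X - C (a (n + 1))) * q (n + 1) - C (b (n + 1)) * q n) (hb : ∀ j, 0 < b j) {n : ℕ} {c : ℝ}
    {z : Fin (n + 1) → ℝ} {x y : Fin (n + 2) → ℝ} (hzq : q (n + 1) = ∏ k, (Polynomial.X - C (z k))) (hx : StrictMono x) (hxq : q (n + 2) = ∏ k, (Polynomial.X - C (x k)))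
    (hy : StrictMono y) (hyq : q (n + 2) - C c * q (n + 1) = ∏ k, (Polynomial.X - C (y k)))
    (hintx : ∀ i : Fin (n + 1), x i.castSucc < z i ∧ z i < x i.succ) (hinty : ∀ i : Fin (n + 1), y i.castSucc < z i ∧ z i < y i.succ) (k : Fin (n + 2)) :
    (0 < c → x k < y k) ∧ (c < 0 → y k < x k) := by
  obtain ⟨hconv, hne⟩ := gapSet_convex_and_ne z (q (n + 1)) hzq k
  have hxS := mem_gapSet_of_interlace hx hintx k
  have hyS := mem_gapSet_of_interlace hy hinty k
  have hmono := recurrence_ratio_strictMonoOn hq0 hq1 hrec hb (n + 1) hconv hne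
  -- the ratio is `0` at `x_k` and `c` at `y_k`
  have hfx : (q (n + 1 + 1)).eval (x k) / (q (n + 1)).eval (x k) = 0 := by
    have h : (q (n + 2)).eval (x k) = 0 := by
      rw [hxq, eval_prod]; exact Finset.prod_eq_zero (Finset.mem_univ k) (by rw [eval_sub, eval_X, eval_C, sub_self])
    rw [show n + 1 + 1 = n + 2 from rfl, h, zero_div]
  have hfy : (q (n + 1 + 1)).eval (y k) / (q (n + 1)).eval (y k) = c := by
    have h : (q (n + 2) - C c * q (n + 1)).eval (y k) = 0 := by
      rw [hyq, eval_prod]; exact Finset.prod_eq_zero (Finset.mem_univ k) (by rw [eval_sub, eval_X, eval_C, sub_self])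
    rw [eval_sub, eval_mul, eval_C, sub_eq_zero] at h
    rw [show n + 1 + 1 = n + 2 from rfl, h, mul_div_assoc, div_self (hne _ hyS), mul_one]
  refine ⟨fun hc => (hmono.lt_iff_lt hxS hyS).1 (by rw [hfx, hfy]; exact hc), fun hc => (hmono.lt_iff_lt hyS hxS).1 (by rw [hfx, hfy]; exact hc)⟩

/-- **STRICT INTERLACING UNDER A POSITIVE CHANGE OF THE LAST DIAGONAL COEFFICIENT**: for `c > 0` the zeros `x` of `q_{n+2}`, `y` of `q_{n+2} − c q_{n+1}` and `z` of `q_{n+1}` satisfy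
`x_k < y_k < z_k < x_{k+1}` (`k ≤ n`) and `x_{n+1} < y_{n+1}`. [Golub 1973 §5; Wilkinson Ch. 2 §40; this file, §1098] -/
theorem top_perturbation_interlace {q : ℕ → ℝ[X]} {a b : ℕ → ℝ} (hq0 : q 0 = 1) (hq1 : q 1 = Polynomial.X - C (a 0))
    (hrec : ∀ n, q (n + 2) = (Polynomial.X - C (a (n + 1))) * q (n + 1) - C (b (n + 1)) * q n) (hb : ∀ j, 0 < b j) (n : ℕ) {c : ℝ} (hc : 0 < c) :
    ∃ (z : Fin (n + 1) → ℝ) (x y : Fin (n + 2) → ℝ), StrictMono z ∧ StrictMono x ∧ StrictMono y ∧ q (n + 1) = ∏ k, (Polynomial.X - C (z k)) ∧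
      q (n + 2) = ∏ k, (Polynomial.X - C (x k)) ∧ q (n + 2) - C c * q (n + 1) = ∏ k, (Polynomial.X - C (y k)) ∧
      (∀ k, x k < y k) ∧ ∀ k : Fin (n + 1), y k.castSucc < z k ∧ z k < x k.succ := by
  obtain ⟨z, x, hz, hx, hzq, hxq, hintx⟩ := recurrence_zeros_interlace hq0 hq1 hrec hb n
  obtain ⟨z', y, hz', hy, hz'q, hyq, hinty⟩ := quasiOrthogonal_zeros_interlace hq0 hq1 hrec hb n c
  have hzz : z' = z := strictMono_eq_of_prod_X_sub_C_eq hz' hz (hz'q.symm.trans hzq)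
  subst hzz
  exact ⟨z', x, y, hz', hx, hy, hz'q, hxq, hyq, fun k => (top_perturbation_zeros_compare hq0 hq1 hrec hb hz'q hx hxq hy hyq hintx hinty k).1 hc,
    fun k => ⟨(hinty k).1, (hintx k).2⟩⟩

end Summit.Ventures.HSemireg.Wedge.HankelOuter
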